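/-
Copyright (c) 2026 the pub-hodgecm-mathlib formalisation cell (harness21).  Prover seat hodgecm-mathlib-R90-C14-p02 (g3) (section S6, dealer R90-C14-plan (g2),
card (G1) «E1-DISCHARGE», R90 bus 2026-09-05T03:03:11Z; census `R90/R90-C14-p02/g3/G1-DISCHARGE-CENSUS.md` 7afcecd4, rulings (Q1)(Q2) + «PLAN =» 03:09:36Z).
FILE 1b = THE REDUCTION of typ1's (E1) target to the two unit-level κ-identities (U0), (U1).  THEOREMS ONLY (no `def`, no `instance`, no notation, no named-fact
hypothesis, no `sorry`); lane `--supports stmt-HodgeConjecture-24833 --as helper` (count-neutral helper).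
-/
import Summits.HodgeConjecture.HodgeConjecture.Theorems.R90S6EllipticIdentityTypeOneShells   -- ★ FILE 1a (this seat): §2 ∕ §3 ∕ §3b shell plumbing
import Summits.HodgeConjecture.HodgeConjecture.Theorems.R90S6FlickerLiteralFrames           -- ★ frames A p864836: `flickerFrame_one_mem_fixedBy`, `flickerFrame_weyl_mem_fixedBy`
import HarnessLib

/-!
# R90 · S6 — CARD (G1) «E1-DISCHARGE», FILE 1b: THE REDUCTION OF THE TYPE-(1) ELLIPTIC κ-IDENTITY (E1) TO THE TWO UNIT-LEVEL IDENTITIES (U0), (U1)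
# (`Theorems/R90S6EllipticIdentityTypeOneReduction.lean`)

Cell `hodgecm-mathlib`, crux H413 (`stmt-HodgeConjecture-24833`), route of record `HCCMUnconditional`; programme R90-TF, section S6 (base `R90-C14`), seat
R90-C14-p02 (g3); card (G1) «E1-DISCHARGE» (dealer R90-C14-plan (g2), R90 bus 2026-09-05T03:03:11Z), census 7afcecd4 §0 ADOPTED AS RECORD 03:09:36Z.
Target of record = typ1 (g3)'s (E1) `delta_mul_kappaSum_ncard_displaced_flicker_eq_sum_xiHCoeff_mul_ncard_displaced_two` (sheet v2.3 `4c174fca74d7a58a` :191;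
conclusion bytes = v2.1 `2c118530033c6343` :180–:206, unchanged).

THE MATHEMATICS (census §0).  Write `V₀ᵢ = #Fix_{γᵢ}(U₃ ⧸ K₀)` (hyperspecial fixed vertices of the Flicker literal `γᵢ`), `V₁ᵢ = #Fix_{γᵢ}(U₃ ⧸ K₁)` (special fixed vertices),
`Φ = #Fix_{X₂}(δ₁)` (ALL fixed vertices of the `{0,2}`-compression `δ₁` on the `(q+1)`-regular tree `X₂`), `Δ = (−q)^{log|(b−a)(b−c)|}`, `Σ± Xᵢ = X₁ + X₂ − X₃ − X₄`.
Every shell of (E1) is a function of these numbers: G side ★ FILE 1a §3b (`S′_{2n+1} + q^{4n}(V₀+V₁) = q^{4n}((q+1)V₁+1)`, `S′_{2(n+1)} + q^{4n+1}(V₀+V₁) =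
q^{4n+1}((q³+1)V₀+1)`, `S′₀ = V₀`); H side: by ★ Transport the two H-sums of (E1) add up to `Σ_k xiHCoeff q m k · T(k)`, `T(k)` the TOTAL shell of `δ₁` (★ FILE 1a §3),
and ★ FILE 1a §2 gives `RHS(m) = (q²−1)q^{2(m−1)}Φ + ((q²−1)q^{2m−3}·[m even ? −1 : 0] + (−1)^m q^{2m−1})·T(1)` with `T(1) + 2Φ = (q+1)Φ + 2`.  A two-line computation per
parity of `m` shows **(E1)(m) for every `m` ⟸ (U0) `Δ·Σ±V₀ᵢ = Φ` ∧ (U1) `Δ·Σ±V₁ᵢ = Φ − 2`** ((U0) is (E1)(0); (U1) ⟺ (E1)(1) given (U0); `m = 2` and the E1-ANCHOR balance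
`hD` cost nothing beyond ★ Transport — census §0, dealer record 03:09:36Z): `m = 2(n+1)`: `LHS − RHS = c q³·(U0) − c·(U1) − c·(T1)`, `c = q^{4n+1}`; `m = 2n+1`:
`LHS − RHS = −c·(U0) + c q·(U1) + c q·(T1)`, `c = q^{4n}` (as `linear_combination`s).
* HEAD **`delta_mul_kappaSum_ncard_displaced_flicker_eq_sum_xiHCoeff_mul_ncard_displaced_two_of_unitLevels`**: (E1)'s conclusion BYTES VERBATIM for every `m`, from (U0) ∧ (U1),
  in (E1)'s letters plus the ruling-(Q2) letters `g₁ hg₁`, `hfin₀ᵢ hfin₁ᵢ` (`i = 1…4`), `x₀ hx₀ hloc hreg` — the `Fintype`-free route: the fixed vertex of each literal is read off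
  ★ frames A (`1·K₀ ∈ Fix(t_1)`, `w₀·K₁ ∈ Fix(t_ϖ)`), the `X₂`-side finiteness off ★ HF1 A3; no `horb`, no section `r`, NO FRAME LETTER (the (Q1) a₀-frame enters only the
  per-regime VALUE files that pay (U0), (U1)).
HONEST LABEL: a reduction (bookkeeping over ★ files); (U0) = the unit FL in tree-count letters and (U1) = its special-level twin remain to be paid per regime (R-III: FILE 2
`R90S6EllipticIdentityTypeOneSeparated`; deep regimes: FILE 0 ∕ R2M ∕ FLSUM, census §2); count-neutral until (E1) v2.3 consumes it.  HC_CM is proved only modulo the 7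
printed citations (2 remaining named inputs: hLiu418 = stmt-HodgeConjecture-24832, h413 = stmt-HodgeConjecture-24833) until rung 0 closes; REL ≠ ★ ≠ BUILT.

## References
* [Rogawski1990] J. D. Rogawski, *Automorphic Representations of Unitary Groups in Three Variables*, Ann. of Math. Stud. 123 (1990): §4.9 Prop. 4.9.1 (b) pp. 54–55
  (the fundamental lemma for `(U(3), U(2)×U(1))`), Lemma 4.9.3 p. 56, §3.5–3.6 pp. 29–32.
* [Flicker1998UnitaryFL] Y. Z. Flicker, *Elementary proof of the fundamental lemma for a unitary group*, Canad. J. Math. 50 (1998): §2 Prop. 3 pp. 78–79, §6 p. 95.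
* [LabesseLanglands1979] J.-P. Labesse, R. P. Langlands, *L-indistinguishability for SL(2)*, Canad. J. Math. 31 (1979), §§2–3.
* [Kottwitz1988] R. E. Kottwitz, *Tamagawa numbers*, Ann. of Math. 127 (1988), §2.
* [Serre1980Trees] J.-P. Serre, *Trees* (1980), I.6.4 Prop. 24, II.1.1.
* [Macdonald1971] I. G. Macdonald, *Spherical Functions on a Group of p-adic Type* (1971), Ch. V §3.
-/


set_option autoImplicit false
-- the mandated namespace repeats the single-problem summit's segment (`HodgeConjecture.HodgeConjecture`)
set_option linter.dupNamespace false

noncomputable section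

open MulAction SimpleGraph Finset
open scoped Valued WithZero Matrix MatrixGroups
open Literature.NumberTheory.Automorphic Literature.NumberTheory.Automorphic.HermitianLattice Literature.NumberTheory.Automorphic.UnitaryGroup
open Literature.Combinatorics.SimpleGraph

namespace Summit.HodgeConjecture.HodgeConjecture.R90.S6

/-! ## §4 HEAD: (E1) for every `m` from the two unit-level identities (U0), (U1) -/

section Head

-- the four `Fintype ↥(fixedBy …)` instances built from `hfin₀ᵢ` and the quotient actions exceed the default synthesis budget in places (same bump as ★ GF1 2a's callers)
set_option synthInstance.maxHeartbeats 400000 in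
set_option maxHeartbeats 1600000 in
/-- **(E1) ⟸ (U0) ∧ (U1) — THE TYPE-(1) ELLIPTIC κ-IDENTITY AT EVERY DISPLACEMENT `m` FROM THE TWO UNIT-LEVEL κ-IDENTITIES.**  In the letters of typ1's (E1)
(sheet v2.3 `4c174fca74d7a58a` :191; conclusion :254–:280 BYTES VERBATIM below): the cell's unramified datum `hd` with the residual letters (`|𝓀| = q²`, `σ̄ = Frob_q`),
`|2| = 1`, `2e = 1`, norm-one `a, b, c` with `a ≠ c`, Flicker's four literals `γ₁ = t_1(a,b,c)`, `γ₂ = t_ϖ(a,b,c)`, `γ₃ = t_ϖ(a,c,b)`, `γ₄ = t_ϖ(b,a,c)` and the two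
compressions `δ₁, δ₂`; the ruling-(Q2) letters `g₁ hg₁`, the coset-finiteness letters `hfin₀ᵢ hfin₁ᵢ` and the `X₂` root ∕ regularity letters `x₀ hx₀ hloc hreg`.
HYPOTHESES (U0) `Δ·(V₀₁ + V₀₂ − V₀₃ − V₀₄) = Φ` and (U1) `Δ·(V₁₁ + V₁₂ − V₁₃ − V₁₄) = Φ − 2`, `Vⱼᵢ = #Fix_{γᵢ}(U₃ ⧸ Kⱼ)`, `Φ = #Fix_{X₂}(δ₁)`,
`Δ = (−q)^{log|(b−a)(b−c)|}`.  CONCLUSION: (E1) at `m`.  Proof: `m = 0` is (U0) (★ G3 + ★ DICT0 ∕ `T(0) = Φ`); for `m ≥ 1` both sides are computed from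
`(V₀ᵢ, V₁ᵢ, Φ, T(1))` (§3b ∕ §2 ∕ §3) and the difference is the displayed linear combination of (U0), (U1) and `T(1) + 2Φ = (q+1)Φ + 2`, per parity of `m`.
No `horb`, no section `r`, no frame letter: the fixed vertex of each literal comes from ★ frames A (`1·K₀ ∈ Fix(t_1)`, `w₀·K₁ ∈ Fix(t_ϖ)`), the `X₂`-side finiteness from ★ HF1 A3.
[cite: Rogawski1990, §4.9 Prop. 4.9.1 (b) pp. 54–55; Lemma 4.9.3 p. 56] [cite: Flicker1998UnitaryFL, §2 Prop. 3 pp. 78–79; §6 p. 95] [cite: LabesseLanglands1979, §§2–3]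
[cite: Kottwitz1988, §2] [cite: Serre1980Trees, I.6.4 Prop. 24, II.1.1] [cite: Macdonald1971, Ch. V §3] -/
theorem delta_mul_kappaSum_ncard_displaced_flicker_eq_sum_xiHCoeff_mul_ncard_displaced_two_of_unitLevels
    {K : Type} [Field K] [Valued K ℤᵐ⁰] [ValuativeRel K] [(Valued.v : Valuation K ℤᵐ⁰).Compatible]
    {σ : K →+* K} {ϖ : K} (hd : HermitianLattice.UnramifiedLocalConjDatum σ ϖ)
    (hσO : ∀ x : 𝒪[K], σ x ∈ 𝒪[K]) (σk : 𝓀[K] →+* 𝓀[K])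
    (hσk : ∀ x : 𝒪[K], IsLocalRing.residue 𝒪[K] ⟨σ x, hσO x⟩ = σk (IsLocalRing.residue 𝒪[K] x))
    [Fintype 𝓀[K]] {q : ℕ} (hq : Fintype.card 𝓀[K] = q ^ 2) (hfrob : ∀ y, σk y = y ^ q)
    (h2 : Valued.v (2 : K) = 1) {e : K} (h2e : 2 * e = 1)
    {a b c : K} (ha : σ a * a = 1) (hb : σ b * b = 1) (hc : σ c * c = 1) (hac : a ≠ c)
    -- Flicker's four classes of the stable class of the `E¹`-type element with eigenvalues `(a, b, c)`, `b` on the `U(1)`-slot; κ-signs `(+,+,−,−)`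
    (γ₁ γ₂ γ₃ γ₄ : unitaryGroupOfForm σ ((StdForm.antidiagonal 3).over K))
    (hγ₁ : ((γ₁ : GL (Fin 3) K) : Matrix (Fin 3) (Fin 3) K) = !![e * (a + c), 0, -(e * (a - c)); 0, b, 0; -(e * (a - c)), 0, e * (a + c)])
    (hγ₂ : ((γ₂ : GL (Fin 3) K) : Matrix (Fin 3) (Fin 3) K) = !![e * (a + c), 0, -(e * (a - c) * ϖ); 0, b, 0; -(e * (a - c) * ϖ⁻¹), 0, e * (a + c)])
    (hγ₃ : ((γ₃ : GL (Fin 3) K) : Matrix (Fin 3) (Fin 3) K) = !![e * (a + b), 0, -(e * (a - b) * ϖ); 0, c, 0; -(e * (a - b) * ϖ⁻¹), 0, e * (a + b)])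
    (hγ₄ : ((γ₄ : GL (Fin 3) K) : Matrix (Fin 3) (Fin 3) K) = !![e * (b + c), 0, -(e * (b - c) * ϖ); 0, a, 0; -(e * (b - c) * ϖ⁻¹), 0, e * (b + c)])
    -- the two classes of the stable class of the `U(1,1)`-part of `γ_H = (δ, b)`: `δ_1`, `δ_ϖ`
    (δ₁ δ₂ : unitaryGroupOfForm σ ((StdForm.antidiagonal 2).over K))
    (hδ₁ : ((δ₁ : GL (Fin 2) K) : Matrix (Fin 2) (Fin 2) K) = !![e * (a + c), -(e * (a - c)); -(e * (a - c)), e * (a + c)])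
    (hδ₂ : ((δ₂ : GL (Fin 2) K) : Matrix (Fin 2) (Fin 2) K) = !![e * (a + c), -(e * (a - c) * ϖ); -(e * (a - c) * ϖ⁻¹), e * (a + c)])
    -- ruling-(Q2) letters (typ1 v2.3): the special vertex `g₁`, the two coset-finiteness letters per literal, the `X₂` root and its `(q+1)`-regularity
    (g₁ : GL (Fin 3) K) (hg₁ : (g₁ : Matrix (Fin 3) (Fin 3) K) = Matrix.diagonal ![(1 : K), 1, ϖ])
    (hfin₀₁ : (fixedBy (↥(unitaryGroupOfForm σ ((StdForm.antidiagonal 3).over K)) ⧸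
      (glInt 3 K).subgroupOf (unitaryGroupOfForm σ ((StdForm.antidiagonal 3).over K))) γ₁).Finite)
    (hfin₁₁ : (fixedBy (↥(unitaryGroupOfForm σ ((StdForm.antidiagonal 3).over K)) ⧸
      ((glInt 3 K).map (MulAut.conj g₁).toMonoidHom).subgroupOf (unitaryGroupOfForm σ ((StdForm.antidiagonal 3).over K))) γ₁).Finite)
    (hfin₀₂ : (fixedBy (↥(unitaryGroupOfForm σ ((StdForm.antidiagonal 3).over K)) ⧸
      (glInt 3 K).subgroupOf (unitaryGroupOfForm σ ((StdForm.antidiagonal 3).over K))) γ₂).Finite)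
    (hfin₁₂ : (fixedBy (↥(unitaryGroupOfForm σ ((StdForm.antidiagonal 3).over K)) ⧸
      ((glInt 3 K).map (MulAut.conj g₁).toMonoidHom).subgroupOf (unitaryGroupOfForm σ ((StdForm.antidiagonal 3).over K))) γ₂).Finite)
    (hfin₀₃ : (fixedBy (↥(unitaryGroupOfForm σ ((StdForm.antidiagonal 3).over K)) ⧸
      (glInt 3 K).subgroupOf (unitaryGroupOfForm σ ((StdForm.antidiagonal 3).over K))) γ₃).Finite)
    (hfin₁₃ : (fixedBy (↥(unitaryGroupOfForm σ ((StdForm.antidiagonal 3).over K)) ⧸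
      ((glInt 3 K).map (MulAut.conj g₁).toMonoidHom).subgroupOf (unitaryGroupOfForm σ ((StdForm.antidiagonal 3).over K))) γ₃).Finite)
    (hfin₀₄ : (fixedBy (↥(unitaryGroupOfForm σ ((StdForm.antidiagonal 3).over K)) ⧸
      (glInt 3 K).subgroupOf (unitaryGroupOfForm σ ((StdForm.antidiagonal 3).over K))) γ₄).Finite)
    (hfin₁₄ : (fixedBy (↥(unitaryGroupOfForm σ ((StdForm.antidiagonal 3).over K)) ⧸
      ((glInt 3 K).map (MulAut.conj g₁).toMonoidHom).subgroupOf (unitaryGroupOfForm σ ((StdForm.antidiagonal 3).over K))) γ₄).Finite)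
    (x₀ : {M : Submodule (ValuativeRel.valuation K).integer (Fin 2 → K) // HermitianLatticeTree.IsSpecialLattice σ ϖ ((StdForm.antidiagonal 2).over K) M})
    (hx₀ : x₀.1 = HermitianLatticeTree.latt (1 : Matrix (Fin 2) (Fin 2) K))
    (hloc : ∀ v, ((HermitianLatticeTree.latticeTree σ ϖ ((StdForm.antidiagonal 2).over K)).neighborSet v).Finite)
    (hreg : ∀ v, ((HermitianLatticeTree.latticeTree σ ϖ ((StdForm.antidiagonal 2).over K)).neighborSet v).ncard = q + 1)
    -- (U0): the unit fundamental lemma in tree-count letters (hyperspecial level); (U1): its special-level twin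
    (hU0 : (-(q : ℂ)) ^ WithZero.log (Valued.v ((b - a) * (b - c))) *
        ((Nat.card (fixedBy (↥(unitaryGroupOfForm σ ((StdForm.antidiagonal 3).over K)) ⧸
            (glInt 3 K).subgroupOf (unitaryGroupOfForm σ ((StdForm.antidiagonal 3).over K))) γ₁) : ℂ) +
          (Nat.card (fixedBy (↥(unitaryGroupOfForm σ ((StdForm.antidiagonal 3).over K)) ⧸
            (glInt 3 K).subgroupOf (unitaryGroupOfForm σ ((StdForm.antidiagonal 3).over K))) γ₂) : ℂ) -
          (Nat.card (fixedBy (↥(unitaryGroupOfForm σ ((StdForm.antidiagonal 3).over K)) ⧸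
            (glInt 3 K).subgroupOf (unitaryGroupOfForm σ ((StdForm.antidiagonal 3).over K))) γ₃) : ℂ) -
          (Nat.card (fixedBy (↥(unitaryGroupOfForm σ ((StdForm.antidiagonal 3).over K)) ⧸
            (glInt 3 K).subgroupOf (unitaryGroupOfForm σ ((StdForm.antidiagonal 3).over K))) γ₄) : ℂ)) =
      (({v | HermitianLatticeTree.latticeTreeIso σ ϖ ((StdForm.antidiagonal 2).over K) δ₁ v = v}.ncard : ℕ) : ℂ))
    (hU1 : (-(q : ℂ)) ^ WithZero.log (Valued.v ((b - a) * (b - c))) *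
        ((Nat.card (fixedBy (↥(unitaryGroupOfForm σ ((StdForm.antidiagonal 3).over K)) ⧸
            ((glInt 3 K).map (MulAut.conj g₁).toMonoidHom).subgroupOf (unitaryGroupOfForm σ ((StdForm.antidiagonal 3).over K))) γ₁) : ℂ) +
          (Nat.card (fixedBy (↥(unitaryGroupOfForm σ ((StdForm.antidiagonal 3).over K)) ⧸
            ((glInt 3 K).map (MulAut.conj g₁).toMonoidHom).subgroupOf (unitaryGroupOfForm σ ((StdForm.antidiagonal 3).over K))) γ₂) : ℂ) -
          (Nat.card (fixedBy (↥(unitaryGroupOfForm σ ((StdForm.antidiagonal 3).over K)) ⧸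
            ((glInt 3 K).map (MulAut.conj g₁).toMonoidHom).subgroupOf (unitaryGroupOfForm σ ((StdForm.antidiagonal 3).over K))) γ₃) : ℂ) -
          (Nat.card (fixedBy (↥(unitaryGroupOfForm σ ((StdForm.antidiagonal 3).over K)) ⧸
            ((glInt 3 K).map (MulAut.conj g₁).toMonoidHom).subgroupOf (unitaryGroupOfForm σ ((StdForm.antidiagonal 3).over K))) γ₄) : ℂ)) =
      (({v | HermitianLatticeTree.latticeTreeIso σ ϖ ((StdForm.antidiagonal 2).over K) δ₁ v = v}.ncard : ℕ) : ℂ) - 2)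
    (m : ℕ) :
    (-(q : ℂ)) ^ WithZero.log (Valued.v ((b - a) * (b - c))) *
        (({x : {M : Submodule 𝒪[K] (Fin 3 → K) // UnitaryLatticeTree.IsVertex σ ϖ ((StdForm.antidiagonal 3).over K) M} |
              UnitaryLatticeTree.IsSelfDualLattice σ ϖ ((StdForm.antidiagonal 3).over K) x.1 ∧
                (UnitaryLatticeTree.latticeGraph σ ϖ ((StdForm.antidiagonal 3).over K)).dist x
                  (UnitaryLatticeTree.latticeGraphPerm σ ϖ ((StdForm.antidiagonal 3).over K) γ₁ x) = 2 * m}.ncard : ℂ) +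
          ({x : {M : Submodule 𝒪[K] (Fin 3 → K) // UnitaryLatticeTree.IsVertex σ ϖ ((StdForm.antidiagonal 3).over K) M} |
              UnitaryLatticeTree.IsSelfDualLattice σ ϖ ((StdForm.antidiagonal 3).over K) x.1 ∧
                (UnitaryLatticeTree.latticeGraph σ ϖ ((StdForm.antidiagonal 3).over K)).dist x
                  (UnitaryLatticeTree.latticeGraphPerm σ ϖ ((StdForm.antidiagonal 3).over K) γ₂ x) = 2 * m}.ncard : ℂ) -
          ({x : {M : Submodule 𝒪[K] (Fin 3 → K) // UnitaryLatticeTree.IsVertex σ ϖ ((StdForm.antidiagonal 3).over K) M} |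
              UnitaryLatticeTree.IsSelfDualLattice σ ϖ ((StdForm.antidiagonal 3).over K) x.1 ∧
                (UnitaryLatticeTree.latticeGraph σ ϖ ((StdForm.antidiagonal 3).over K)).dist x
                  (UnitaryLatticeTree.latticeGraphPerm σ ϖ ((StdForm.antidiagonal 3).over K) γ₃ x) = 2 * m}.ncard : ℂ) -
          ({x : {M : Submodule 𝒪[K] (Fin 3 → K) // UnitaryLatticeTree.IsVertex σ ϖ ((StdForm.antidiagonal 3).over K) M} |
              UnitaryLatticeTree.IsSelfDualLattice σ ϖ ((StdForm.antidiagonal 3).over K) x.1 ∧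
                (UnitaryLatticeTree.latticeGraph σ ϖ ((StdForm.antidiagonal 3).over K)).dist x
                  (UnitaryLatticeTree.latticeGraphPerm σ ϖ ((StdForm.antidiagonal 3).over K) γ₄ x) = 2 * m}.ncard : ℂ)) =
      (∑ k ∈ Finset.range (m + 1), xiHCoeff q m k *
          ({x : {M : Submodule (ValuativeRel.valuation K).integer (Fin 2 → K) // HermitianLatticeTree.IsSpecialLattice σ ϖ ((StdForm.antidiagonal 2).over K) M} |
              HermitianLatticeTree.IsSelfDualLattice σ ((StdForm.antidiagonal 2).over K) x.1 ∧
                (HermitianLatticeTree.latticeTree σ ϖ ((StdForm.antidiagonal 2).over K)).dist x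
                  (HermitianLatticeTree.latticeTreeIso σ ϖ ((StdForm.antidiagonal 2).over K) δ₁ x) = 2 * k}.ncard : ℂ)) +
        ∑ k ∈ Finset.range (m + 1), xiHCoeff q m k *
          ({x : {M : Submodule (ValuativeRel.valuation K).integer (Fin 2 → K) // HermitianLatticeTree.IsSpecialLattice σ ϖ ((StdForm.antidiagonal 2).over K) M} |
              HermitianLatticeTree.IsSelfDualLattice σ ((StdForm.antidiagonal 2).over K) x.1 ∧
                (HermitianLatticeTree.latticeTree σ ϖ ((StdForm.antidiagonal 2).over K)).dist x
                  (HermitianLatticeTree.latticeTreeIso σ ϖ ((StdForm.antidiagonal 2).over K) δ₂ x) = 2 * k}.ncard : ℂ) := by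
  classical
  have hϖ0 : ϖ ≠ 0 := CartanUnique.uniformizer_ne_zero hd.vϖ
  -- ★ frames A: every literal fixes a coset (`1·K₀` for `t_1`, `w₀·K₁` for the `t_ϖ`'s)
  have hne₁ : (fixedBy (↥(unitaryGroupOfForm σ ((StdForm.antidiagonal 3).over K)) ⧸ (glInt 3 K).subgroupOf (unitaryGroupOfForm σ ((StdForm.antidiagonal 3).over K))) γ₁).Nonempty ∨
      (fixedBy (↥(unitaryGroupOfForm σ ((StdForm.antidiagonal 3).over K)) ⧸ ((glInt 3 K).map (MulAut.conj g₁).toMonoidHom).subgroupOf (unitaryGroupOfForm σ ((StdForm.antidiagonal 3).over K))) γ₁).Nonempty :=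
    Or.inl ⟨_, flickerFrame_one_mem_fixedBy hd.vσ h2 h2e ha hb hc γ₁ hγ₁⟩
  have hne₂ : (fixedBy (↥(unitaryGroupOfForm σ ((StdForm.antidiagonal 3).over K)) ⧸ (glInt 3 K).subgroupOf (unitaryGroupOfForm σ ((StdForm.antidiagonal 3).over K))) γ₂).Nonempty ∨
      (fixedBy (↥(unitaryGroupOfForm σ ((StdForm.antidiagonal 3).over K)) ⧸ ((glInt 3 K).map (MulAut.conj g₁).toMonoidHom).subgroupOf (unitaryGroupOfForm σ ((StdForm.antidiagonal 3).over K))) γ₂).Nonempty :=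
    Or.inr ⟨_, flickerFrame_weyl_mem_fixedBy hd.vσ h2 h2e hϖ0 ha hb hc g₁ hg₁ (weylLongU σ rfl) (coe_coe_weylLongU_three σ rfl) γ₂ hγ₂⟩
  have hne₃ : (fixedBy (↥(unitaryGroupOfForm σ ((StdForm.antidiagonal 3).over K)) ⧸ (glInt 3 K).subgroupOf (unitaryGroupOfForm σ ((StdForm.antidiagonal 3).over K))) γ₃).Nonempty ∨
      (fixedBy (↥(unitaryGroupOfForm σ ((StdForm.antidiagonal 3).over K)) ⧸ ((glInt 3 K).map (MulAut.conj g₁).toMonoidHom).subgroupOf (unitaryGroupOfForm σ ((StdForm.antidiagonal 3).over K))) γ₃).Nonempty :=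
    Or.inr ⟨_, flickerFrame_weyl_mem_fixedBy hd.vσ h2 h2e hϖ0 ha hc hb g₁ hg₁ (weylLongU σ rfl) (coe_coe_weylLongU_three σ rfl) γ₃ hγ₃⟩
  have hne₄ : (fixedBy (↥(unitaryGroupOfForm σ ((StdForm.antidiagonal 3).over K)) ⧸ (glInt 3 K).subgroupOf (unitaryGroupOfForm σ ((StdForm.antidiagonal 3).over K))) γ₄).Nonempty ∨
      (fixedBy (↥(unitaryGroupOfForm σ ((StdForm.antidiagonal 3).over K)) ⧸ ((glInt 3 K).map (MulAut.conj g₁).toMonoidHom).subgroupOf (unitaryGroupOfForm σ ((StdForm.antidiagonal 3).over K))) γ₄).Nonempty :=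
    Or.inr ⟨_, flickerFrame_weyl_mem_fixedBy hd.vσ h2 h2e hϖ0 hb ha hc g₁ hg₁ (weylLongU σ rfl) (coe_coe_weylLongU_three σ rfl) γ₄ hγ₄⟩
  -- G side: the shells of each literal from its two fixed-coset counts (§3b)
  obtain ⟨hZ₁, hO₁, hE₁⟩ := ncard_selfDual_displaced_eq_of_finite_fixedBy hd hσO σk hσk hq hfrob g₁ hg₁ γ₁ hfin₀₁ hfin₁₁ hne₁
  obtain ⟨hZ₂, hO₂, hE₂⟩ := ncard_selfDual_displaced_eq_of_finite_fixedBy hd hσO σk hσk hq hfrob g₁ hg₁ γ₂ hfin₀₂ hfin₁₂ hne₂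
  obtain ⟨hZ₃, hO₃, hE₃⟩ := ncard_selfDual_displaced_eq_of_finite_fixedBy hd hσO σk hσk hq hfrob g₁ hg₁ γ₃ hfin₀₃ hfin₁₃ hne₃
  obtain ⟨hZ₄, hO₄, hE₄⟩ := ncard_selfDual_displaced_eq_of_finite_fixedBy hd hσO σk hσk hq hfrob g₁ hg₁ γ₄ hfin₀₄ hfin₁₄ hne₄
  -- H side: `Fix δ₁ = Ball(x₀, v(a−c))` is finite and contains the root; `δ₂ = diag(ϖ,1)δ₁diag(ϖ,1)⁻¹`
  obtain ⟨hfixH, hx₀fix⟩ := finite_compression_fixed hd h2 h2e ha hc hac δ₁ hδ₁ x₀ hx₀ hloc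
  have hconj := coe_compression_pi_eq_zpowDiagGL_conj hd δ₁ δ₂ hδ₁ hδ₂
  haveI := isDiscreteValuationRing_integer_of_compatible hd.vϖ
  have hT := HermitianLatticeTree.isTree_latticeTree σ (valuation_map_eq_of_datum hd) (isUniformizingElement_of_v_eq hd.vϖ)
    (isUnimodular₂_antidiagonal_two (K := K))
  haveI : (HermitianLatticeTree.latticeTree σ ϖ ((StdForm.antidiagonal 2).over K)).LocallyFinite := fun v => (hloc v).fintype
  have hpair : ∀ k : ℕ,
      {x : {M : Submodule (ValuativeRel.valuation K).integer (Fin 2 → K) // HermitianLatticeTree.IsSpecialLattice σ ϖ ((StdForm.antidiagonal 2).over K) M} |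
            HermitianLatticeTree.IsSelfDualLattice σ ((StdForm.antidiagonal 2).over K) x.1 ∧
              (HermitianLatticeTree.latticeTree σ ϖ ((StdForm.antidiagonal 2).over K)).dist x
                (HermitianLatticeTree.latticeTreeIso σ ϖ ((StdForm.antidiagonal 2).over K) δ₁ x) = 2 * k}.ncard +
          {x : {M : Submodule (ValuativeRel.valuation K).integer (Fin 2 → K) // HermitianLatticeTree.IsSpecialLattice σ ϖ ((StdForm.antidiagonal 2).over K) M} |
            HermitianLatticeTree.IsSelfDualLattice σ ((StdForm.antidiagonal 2).over K) x.1 ∧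
              (HermitianLatticeTree.latticeTree σ ϖ ((StdForm.antidiagonal 2).over K)).dist x
                (HermitianLatticeTree.latticeTreeIso σ ϖ ((StdForm.antidiagonal 2).over K) δ₂ x) = 2 * k}.ncard =
        {x : {M : Submodule (ValuativeRel.valuation K).integer (Fin 2 → K) // HermitianLatticeTree.IsSpecialLattice σ ϖ ((StdForm.antidiagonal 2).over K) M} |
          (HermitianLatticeTree.latticeTree σ ϖ ((StdForm.antidiagonal 2).over K)).dist x
            (HermitianLatticeTree.latticeTreeIso σ ϖ ((StdForm.antidiagonal 2).over K) δ₁ x) = 2 * k}.ncard := fun k =>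
    ncard_selfDual_displaced_add_eq_ncard_displaced hd δ₁ δ₂ hconj (2 * k)
      (TreeDisplacement.finite_setOf_dist_self_apply_eq hT (HermitianLatticeTree.latticeTreeIso σ ϖ ((StdForm.antidiagonal 2).over K) δ₁) hx₀fix hfixH k)
  have hT1 : (({x : {M : Submodule (ValuativeRel.valuation K).integer (Fin 2 → K) // HermitianLatticeTree.IsSpecialLattice σ ϖ ((StdForm.antidiagonal 2).over K) M} |
        (HermitianLatticeTree.latticeTree σ ϖ ((StdForm.antidiagonal 2).over K)).dist x
          (HermitianLatticeTree.latticeTreeIso σ ϖ ((StdForm.antidiagonal 2).over K) δ₁ x) = 2}.ncard : ℕ) : ℂ) +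
      2 * (({v | HermitianLatticeTree.latticeTreeIso σ ϖ ((StdForm.antidiagonal 2).over K) δ₁ v = v}.ncard : ℕ) : ℂ) =
      ((q : ℂ) + 1) * (({v | HermitianLatticeTree.latticeTreeIso σ ϖ ((StdForm.antidiagonal 2).over K) δ₁ v = v}.ncard : ℕ) : ℂ) + 2 := by
    exact_mod_cast ncard_displaced_two_add_two_mul_ncard_fixed_eq hd δ₁ hx₀fix hfixH hloc q hreg
  -- the two H-sums add up to the sum against the total shells of `δ₁`
  rw [← Finset.sum_add_distrib]
  have hsum : ∀ k ∈ Finset.range (m + 1), xiHCoeff q m k *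
        (({x : {M : Submodule (ValuativeRel.valuation K).integer (Fin 2 → K) // HermitianLatticeTree.IsSpecialLattice σ ϖ ((StdForm.antidiagonal 2).over K) M} |
            HermitianLatticeTree.IsSelfDualLattice σ ((StdForm.antidiagonal 2).over K) x.1 ∧
              (HermitianLatticeTree.latticeTree σ ϖ ((StdForm.antidiagonal 2).over K)).dist x
                (HermitianLatticeTree.latticeTreeIso σ ϖ ((StdForm.antidiagonal 2).over K) δ₁ x) = 2 * k}.ncard : ℕ) : ℂ) +
        xiHCoeff q m k *
        (({x : {M : Submodule (ValuativeRel.valuation K).integer (Fin 2 → K) // HermitianLatticeTree.IsSpecialLattice σ ϖ ((StdForm.antidiagonal 2).over K) M} |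
            HermitianLatticeTree.IsSelfDualLattice σ ((StdForm.antidiagonal 2).over K) x.1 ∧
              (HermitianLatticeTree.latticeTree σ ϖ ((StdForm.antidiagonal 2).over K)).dist x
                (HermitianLatticeTree.latticeTreeIso σ ϖ ((StdForm.antidiagonal 2).over K) δ₂ x) = 2 * k}.ncard : ℕ) : ℂ) =
      xiHCoeff q m k *
        (({x : {M : Submodule (ValuativeRel.valuation K).integer (Fin 2 → K) // HermitianLatticeTree.IsSpecialLattice σ ϖ ((StdForm.antidiagonal 2).over K) M} |
          (HermitianLatticeTree.latticeTree σ ϖ ((StdForm.antidiagonal 2).over K)).dist x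
            (HermitianLatticeTree.latticeTreeIso σ ϖ ((StdForm.antidiagonal 2).over K) δ₁ x) = 2 * k}.ncard : ℕ) : ℂ) := fun k _ => by
    rw [← mul_add, ← Nat.cast_add, hpair k]
  rw [Finset.sum_congr rfl hsum]
  rcases Nat.eq_zero_or_pos m with rfl | hm
  · -- `m = 0`: (U0)
    have hT0 : {x : {M : Submodule (ValuativeRel.valuation K).integer (Fin 2 → K) // HermitianLatticeTree.IsSpecialLattice σ ϖ ((StdForm.antidiagonal 2).over K) M} |
          (HermitianLatticeTree.latticeTree σ ϖ ((StdForm.antidiagonal 2).over K)).dist x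
            (HermitianLatticeTree.latticeTreeIso σ ϖ ((StdForm.antidiagonal 2).over K) δ₁ x) = 2 * 0}.ncard =
        {v | HermitianLatticeTree.latticeTreeIso σ ϖ ((StdForm.antidiagonal 2).over K) δ₁ v = v}.ncard := by
      congr 1
      ext x
      simp only [Set.mem_setOf_eq, Nat.mul_zero, hT.connected.dist_eq_zero_iff]
      exact eq_comm
    rw [zero_add, Finset.sum_range_one, xiHCoeff_self, pow_zero, one_mul, hT0, hZ₁, hZ₂, hZ₃, hZ₄]
    exact hU0
  · rw [sum_xiHCoeff_mul_ncard_displaced_total_eq hd δ₁ hx₀fix hfixH hloc q hreg m hm]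
    rcases Nat.even_or_odd' m with ⟨n, rfl | rfl⟩
    · -- `m = 2(n+1)` even
      obtain ⟨n, rfl⟩ : ∃ n', n = n' + 1 := Nat.exists_eq_succ_of_ne_zero (by omega)
      have g1 := hE₁ n
      have g2 := hE₂ n
      have g3 := hE₃ n
      have g4 := hE₄ n
      have c1 : (({x : {M : Submodule 𝒪[K] (Fin 3 → K) // UnitaryLatticeTree.IsVertex σ ϖ ((StdForm.antidiagonal 3).over K) M} |
              UnitaryLatticeTree.IsSelfDualLattice σ ϖ ((StdForm.antidiagonal 3).over K) x.1 ∧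
                (UnitaryLatticeTree.latticeGraph σ ϖ ((StdForm.antidiagonal 3).over K)).dist x
                  (UnitaryLatticeTree.latticeGraphPerm σ ϖ ((StdForm.antidiagonal 3).over K) γ₁ x) = 2 * (2 * (n + 1))}.ncard : ℕ) : ℂ) =
          (q : ℂ) ^ (4 * n + 1) * (((q : ℂ) ^ 3 + 1) * (Nat.card (fixedBy (↥(unitaryGroupOfForm σ ((StdForm.antidiagonal 3).over K)) ⧸
            (glInt 3 K).subgroupOf (unitaryGroupOfForm σ ((StdForm.antidiagonal 3).over K))) γ₁) : ℂ) + 1) -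
            (q : ℂ) ^ (4 * n + 1) * ((Nat.card (fixedBy (↥(unitaryGroupOfForm σ ((StdForm.antidiagonal 3).over K)) ⧸
            (glInt 3 K).subgroupOf (unitaryGroupOfForm σ ((StdForm.antidiagonal 3).over K))) γ₁) : ℂ) + (Nat.card (fixedBy (↥(unitaryGroupOfForm σ ((StdForm.antidiagonal 3).over K)) ⧸
            ((glInt 3 K).map (MulAut.conj g₁).toMonoidHom).subgroupOf (unitaryGroupOfForm σ ((StdForm.antidiagonal 3).over K))) γ₁) : ℂ)) := by
        rw [eq_sub_iff_add_eq]; exact_mod_cast g1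
      have c2 : (({x : {M : Submodule 𝒪[K] (Fin 3 → K) // UnitaryLatticeTree.IsVertex σ ϖ ((StdForm.antidiagonal 3).over K) M} |
              UnitaryLatticeTree.IsSelfDualLattice σ ϖ ((StdForm.antidiagonal 3).over K) x.1 ∧
                (UnitaryLatticeTree.latticeGraph σ ϖ ((StdForm.antidiagonal 3).over K)).dist x
                  (UnitaryLatticeTree.latticeGraphPerm σ ϖ ((StdForm.antidiagonal 3).over K) γ₂ x) = 2 * (2 * (n + 1))}.ncard : ℕ) : ℂ) =
          (q : ℂ) ^ (4 * n + 1) * (((q : ℂ) ^ 3 + 1) * (Nat.card (fixedBy (↥(unitaryGroupOfForm σ ((StdForm.antidiagonal 3).over K)) ⧸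
            (glInt 3 K).subgroupOf (unitaryGroupOfForm σ ((StdForm.antidiagonal 3).over K))) γ₂) : ℂ) + 1) -
            (q : ℂ) ^ (4 * n + 1) * ((Nat.card (fixedBy (↥(unitaryGroupOfForm σ ((StdForm.antidiagonal 3).over K)) ⧸
            (glInt 3 K).subgroupOf (unitaryGroupOfForm σ ((StdForm.antidiagonal 3).over K))) γ₂) : ℂ) + (Nat.card (fixedBy (↥(unitaryGroupOfForm σ ((StdForm.antidiagonal 3).over K)) ⧸
            ((glInt 3 K).map (MulAut.conj g₁).toMonoidHom).subgroupOf (unitaryGroupOfForm σ ((StdForm.antidiagonal 3).over K))) γ₂) : ℂ)) := by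
        rw [eq_sub_iff_add_eq]; exact_mod_cast g2
      have c3 : (({x : {M : Submodule 𝒪[K] (Fin 3 → K) // UnitaryLatticeTree.IsVertex σ ϖ ((StdForm.antidiagonal 3).over K) M} |
              UnitaryLatticeTree.IsSelfDualLattice σ ϖ ((StdForm.antidiagonal 3).over K) x.1 ∧
                (UnitaryLatticeTree.latticeGraph σ ϖ ((StdForm.antidiagonal 3).over K)).dist x
                  (UnitaryLatticeTree.latticeGraphPerm σ ϖ ((StdForm.antidiagonal 3).over K) γ₃ x) = 2 * (2 * (n + 1))}.ncard : ℕ) : ℂ) =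
          (q : ℂ) ^ (4 * n + 1) * (((q : ℂ) ^ 3 + 1) * (Nat.card (fixedBy (↥(unitaryGroupOfForm σ ((StdForm.antidiagonal 3).over K)) ⧸
            (glInt 3 K).subgroupOf (unitaryGroupOfForm σ ((StdForm.antidiagonal 3).over K))) γ₃) : ℂ) + 1) -
            (q : ℂ) ^ (4 * n + 1) * ((Nat.card (fixedBy (↥(unitaryGroupOfForm σ ((StdForm.antidiagonal 3).over K)) ⧸
            (glInt 3 K).subgroupOf (unitaryGroupOfForm σ ((StdForm.antidiagonal 3).over K))) γ₃) : ℂ) + (Nat.card (fixedBy (↥(unitaryGroupOfForm σ ((StdForm.antidiagonal 3).over K)) ⧸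
            ((glInt 3 K).map (MulAut.conj g₁).toMonoidHom).subgroupOf (unitaryGroupOfForm σ ((StdForm.antidiagonal 3).over K))) γ₃) : ℂ)) := by
        rw [eq_sub_iff_add_eq]; exact_mod_cast g3
      have c4 : (({x : {M : Submodule 𝒪[K] (Fin 3 → K) // UnitaryLatticeTree.IsVertex σ ϖ ((StdForm.antidiagonal 3).over K) M} |
              UnitaryLatticeTree.IsSelfDualLattice σ ϖ ((StdForm.antidiagonal 3).over K) x.1 ∧
                (UnitaryLatticeTree.latticeGraph σ ϖ ((StdForm.antidiagonal 3).over K)).dist x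
                  (UnitaryLatticeTree.latticeGraphPerm σ ϖ ((StdForm.antidiagonal 3).over K) γ₄ x) = 2 * (2 * (n + 1))}.ncard : ℕ) : ℂ) =
          (q : ℂ) ^ (4 * n + 1) * (((q : ℂ) ^ 3 + 1) * (Nat.card (fixedBy (↥(unitaryGroupOfForm σ ((StdForm.antidiagonal 3).over K)) ⧸
            (glInt 3 K).subgroupOf (unitaryGroupOfForm σ ((StdForm.antidiagonal 3).over K))) γ₄) : ℂ) + 1) -
            (q : ℂ) ^ (4 * n + 1) * ((Nat.card (fixedBy (↥(unitaryGroupOfForm σ ((StdForm.antidiagonal 3).over K)) ⧸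
            (glInt 3 K).subgroupOf (unitaryGroupOfForm σ ((StdForm.antidiagonal 3).over K))) γ₄) : ℂ) + (Nat.card (fixedBy (↥(unitaryGroupOfForm σ ((StdForm.antidiagonal 3).over K)) ⧸
            ((glInt 3 K).map (MulAut.conj g₁).toMonoidHom).subgroupOf (unitaryGroupOfForm σ ((StdForm.antidiagonal 3).over K))) γ₄) : ℂ)) := by
        rw [eq_sub_iff_add_eq]; exact_mod_cast g4
      rw [c1, c2, c3, c4, if_pos (even_two_mul (n + 1)), (even_two_mul (n + 1)).neg_one_pow,
        show 2 * (2 * (n + 1) - 1) = 4 * n + 2 by omega, show 2 * (2 * (n + 1)) - 3 = 4 * n + 1 by omega,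
        show 2 * (2 * (n + 1)) - 1 = 4 * n + 3 by omega]
      linear_combination ((q : ℂ) ^ (4 * n + 1) * (q : ℂ) ^ 3) * hU0 + (-(q : ℂ) ^ (4 * n + 1)) * hU1 + (-(q : ℂ) ^ (4 * n + 1)) * hT1
    · -- `m = 2n+1` odd
      have g1 := hO₁ n
      have g2 := hO₂ n
      have g3 := hO₃ n
      have g4 := hO₄ n
      have c1 : (({x : {M : Submodule 𝒪[K] (Fin 3 → K) // UnitaryLatticeTree.IsVertex σ ϖ ((StdForm.antidiagonal 3).over K) M} |
              UnitaryLatticeTree.IsSelfDualLattice σ ϖ ((StdForm.antidiagonal 3).over K) x.1 ∧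
                (UnitaryLatticeTree.latticeGraph σ ϖ ((StdForm.antidiagonal 3).over K)).dist x
                  (UnitaryLatticeTree.latticeGraphPerm σ ϖ ((StdForm.antidiagonal 3).over K) γ₁ x) = 2 * (2 * n + 1)}.ncard : ℕ) : ℂ) =
          (q : ℂ) ^ (4 * n) * (((q : ℂ) + 1) * (Nat.card (fixedBy (↥(unitaryGroupOfForm σ ((StdForm.antidiagonal 3).over K)) ⧸
            ((glInt 3 K).map (MulAut.conj g₁).toMonoidHom).subgroupOf (unitaryGroupOfForm σ ((StdForm.antidiagonal 3).over K))) γ₁) : ℂ) + 1) -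
            (q : ℂ) ^ (4 * n) * ((Nat.card (fixedBy (↥(unitaryGroupOfForm σ ((StdForm.antidiagonal 3).over K)) ⧸
            (glInt 3 K).subgroupOf (unitaryGroupOfForm σ ((StdForm.antidiagonal 3).over K))) γ₁) : ℂ) + (Nat.card (fixedBy (↥(unitaryGroupOfForm σ ((StdForm.antidiagonal 3).over K)) ⧸
            ((glInt 3 K).map (MulAut.conj g₁).toMonoidHom).subgroupOf (unitaryGroupOfForm σ ((StdForm.antidiagonal 3).over K))) γ₁) : ℂ)) := by
        rw [eq_sub_iff_add_eq]; exact_mod_cast g1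
      have c2 : (({x : {M : Submodule 𝒪[K] (Fin 3 → K) // UnitaryLatticeTree.IsVertex σ ϖ ((StdForm.antidiagonal 3).over K) M} |
              UnitaryLatticeTree.IsSelfDualLattice σ ϖ ((StdForm.antidiagonal 3).over K) x.1 ∧
                (UnitaryLatticeTree.latticeGraph σ ϖ ((StdForm.antidiagonal 3).over K)).dist x
                  (UnitaryLatticeTree.latticeGraphPerm σ ϖ ((StdForm.antidiagonal 3).over K) γ₂ x) = 2 * (2 * n + 1)}.ncard : ℕ) : ℂ) =
          (q : ℂ) ^ (4 * n) * (((q : ℂ) + 1) * (Nat.card (fixedBy (↥(unitaryGroupOfForm σ ((StdForm.antidiagonal 3).over K)) ⧸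
            ((glInt 3 K).map (MulAut.conj g₁).toMonoidHom).subgroupOf (unitaryGroupOfForm σ ((StdForm.antidiagonal 3).over K))) γ₂) : ℂ) + 1) -
            (q : ℂ) ^ (4 * n) * ((Nat.card (fixedBy (↥(unitaryGroupOfForm σ ((StdForm.antidiagonal 3).over K)) ⧸
            (glInt 3 K).subgroupOf (unitaryGroupOfForm σ ((StdForm.antidiagonal 3).over K))) γ₂) : ℂ) + (Nat.card (fixedBy (↥(unitaryGroupOfForm σ ((StdForm.antidiagonal 3).over K)) ⧸
            ((glInt 3 K).map (MulAut.conj g₁).toMonoidHom).subgroupOf (unitaryGroupOfForm σ ((StdForm.antidiagonal 3).over K))) γ₂) : ℂ)) := by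
        rw [eq_sub_iff_add_eq]; exact_mod_cast g2
      have c3 : (({x : {M : Submodule 𝒪[K] (Fin 3 → K) // UnitaryLatticeTree.IsVertex σ ϖ ((StdForm.antidiagonal 3).over K) M} |
              UnitaryLatticeTree.IsSelfDualLattice σ ϖ ((StdForm.antidiagonal 3).over K) x.1 ∧
                (UnitaryLatticeTree.latticeGraph σ ϖ ((StdForm.antidiagonal 3).over K)).dist x
                  (UnitaryLatticeTree.latticeGraphPerm σ ϖ ((StdForm.antidiagonal 3).over K) γ₃ x) = 2 * (2 * n + 1)}.ncard : ℕ) : ℂ) =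
          (q : ℂ) ^ (4 * n) * (((q : ℂ) + 1) * (Nat.card (fixedBy (↥(unitaryGroupOfForm σ ((StdForm.antidiagonal 3).over K)) ⧸
            ((glInt 3 K).map (MulAut.conj g₁).toMonoidHom).subgroupOf (unitaryGroupOfForm σ ((StdForm.antidiagonal 3).over K))) γ₃) : ℂ) + 1) -
            (q : ℂ) ^ (4 * n) * ((Nat.card (fixedBy (↥(unitaryGroupOfForm σ ((StdForm.antidiagonal 3).over K)) ⧸
            (glInt 3 K).subgroupOf (unitaryGroupOfForm σ ((StdForm.antidiagonal 3).over K))) γ₃) : ℂ) + (Nat.card (fixedBy (↥(unitaryGroupOfForm σ ((StdForm.antidiagonal 3).over K)) ⧸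
            ((glInt 3 K).map (MulAut.conj g₁).toMonoidHom).subgroupOf (unitaryGroupOfForm σ ((StdForm.antidiagonal 3).over K))) γ₃) : ℂ)) := by
        rw [eq_sub_iff_add_eq]; exact_mod_cast g3
      have c4 : (({x : {M : Submodule 𝒪[K] (Fin 3 → K) // UnitaryLatticeTree.IsVertex σ ϖ ((StdForm.antidiagonal 3).over K) M} |
              UnitaryLatticeTree.IsSelfDualLattice σ ϖ ((StdForm.antidiagonal 3).over K) x.1 ∧
                (UnitaryLatticeTree.latticeGraph σ ϖ ((StdForm.antidiagonal 3).over K)).dist x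
                  (UnitaryLatticeTree.latticeGraphPerm σ ϖ ((StdForm.antidiagonal 3).over K) γ₄ x) = 2 * (2 * n + 1)}.ncard : ℕ) : ℂ) =
          (q : ℂ) ^ (4 * n) * (((q : ℂ) + 1) * (Nat.card (fixedBy (↥(unitaryGroupOfForm σ ((StdForm.antidiagonal 3).over K)) ⧸
            ((glInt 3 K).map (MulAut.conj g₁).toMonoidHom).subgroupOf (unitaryGroupOfForm σ ((StdForm.antidiagonal 3).over K))) γ₄) : ℂ) + 1) -
            (q : ℂ) ^ (4 * n) * ((Nat.card (fixedBy (↥(unitaryGroupOfForm σ ((StdForm.antidiagonal 3).over K)) ⧸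
            (glInt 3 K).subgroupOf (unitaryGroupOfForm σ ((StdForm.antidiagonal 3).over K))) γ₄) : ℂ) + (Nat.card (fixedBy (↥(unitaryGroupOfForm σ ((StdForm.antidiagonal 3).over K)) ⧸
            ((glInt 3 K).map (MulAut.conj g₁).toMonoidHom).subgroupOf (unitaryGroupOfForm σ ((StdForm.antidiagonal 3).over K))) γ₄) : ℂ)) := by
        rw [eq_sub_iff_add_eq]; exact_mod_cast g4
      have hodd : ¬ Even (2 * n + 1) := Nat.not_even_iff_odd.2 (odd_two_mul_add_one n)
      rw [c1, c2, c3, c4, if_neg hodd, (odd_two_mul_add_one n).neg_one_pow,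
        show 2 * (2 * n + 1 - 1) = 4 * n by omega, show 2 * (2 * n + 1) - 1 = 4 * n + 1 by omega]
      linear_combination (-(q : ℂ) ^ (4 * n)) * hU0 + ((q : ℂ) ^ (4 * n) * (q : ℂ)) * hU1 + ((q : ℂ) ^ (4 * n) * (q : ℂ)) * hT1

end Head

end Summit.HodgeConjecture.HodgeConjecture.R90.S6

end
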